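import Summits.Ventures.HSemireg.Pad4TowerPsiSubA1

/-!
# Venture HSemireg — PAD-4: the SIX e-FREE ANNIHILATORS Λ₂, Λ₃, Λ₄a, Λ₄b, Λ₅, Λ₆ of `ℚ[h] ⊕ W` (gs-eng-2 g51 RESULT 5) as kernel
# functionals — annihilation of the class screen (A1), closed forms on balanced blocks, `12Λ = 2(Λ₄a − Λ₄b)` (Ψ inside the degree-4
# pair), and the presence clauses of the W-SEARCH-Δ FULL recipe, each implied by (A1) for EVERY multiplicity vector

HONEST FRAMING. Lean index of the computation cell `pub-hsemireg` (S4-PUSH, H2 door PAD-4), typed by the Ventures-side typer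
`hodge-lit-semireg-typer-2` (g4; line of record stmt-HodgeConjecture-18881 `Cruxes/BlochSeedDiscOne/Lines/birth.lean` 814a6a70c14e831a,
stub `stub_rung_pad4_seedAt`, screen (H1); card v4.10 rows W13 (B′) «RESULT 5 six e-free annihilators + FULL-variant recipe» and W14
«encoder requirement: presence clauses Ψ, Λ₂, Λ₃, Λ₄b, Λ₅, Λ₆»). Third file of the KERNEL LEMMA Ψ ⊂ (A1) set: `Pad4TowerClassScreen`
(the pad4lib class frame, the class screen (A1), the general annihilator criterion `wsum_mul_eq_zero_of_classScreen`, `Λ₁₂ = 12Λ`),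
`Pad4TowerPsiSubA1` (𝔅(μ₄) cells and FILE A designs: the Ψ-row and the Ψ-clause from (A1)); THIS FILE types gs-eng-2 g51's RESULT 5
(cell INBOX l.31736, 2026-08-27T23:32:59Z; `general-structure/gs2/g51/fccore/efree.py` ca398a04069a5de3 `NORM`, `efree_tables.py`
ed5545a140b5953e; validated there exactly on g50's seed b8eaa9e3e594b899 and on D_ML8's (H1) solution j290698): «e-free words have values
in {1, α, α, s} (s_f = α_f² − c_f²), h-degree #u+#v+2#p; an S₄-symmetric functional annihilates ℚ[h] ⊕ W iff its coefficients sum to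
0 inside its degree; the degrees with ≥ 2 word-types (2,3,4,5,6) give exactly 1+1+2+1+1 = SIX independent functionals Λ₂ = 3Σ_f s_f −
2e₂(α) · Λ₃ = Σ_{f≠g} s_f α_g − 3e₃(α) · Λ₄a = 2Σ_{f<g} s_f s_g − Σ_j s_j e₂(α∖j) · Λ₄b = Σ_{f<g} s_f s_g − 6e₄(α) · Λ₅ = Σ_{f<g; h∉fg}
s_f s_g α_h − 3Σ_j s_j e₃(α∖j) · Λ₆ = 3e₃(s) − 2Σ_{f<g} s_f s_g α_k α_l; psi ≡ (Λ₄a − Λ₄b)∕6; each satisfies Σ_S ε_Z m_Z Λ_k(Z) = 0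
under (A1) ⇒ five NEW necessary clauses of the Ψ-shape for the FULL variant: «some class with ε·Λ_k > 0 present ⇒ some class with
ε·Λ_k < 0 present» and conversely». (RESULT 5's `s_f` is the `p`-ENTRY `α_f² − |β_f|²` of the letter vector — NOT the `s = |β|²` of the
Ψ closed form; below it is called `p_f`.)

REPRESENTATIVES. RESULT 5's functionals are `S₄`-symmetric sums over ALL e-free words of a type (letters `u` and `v` both allowed, values
equal since the block is balanced, `u = v = α`). This file types, for each Λ_k, the `u`-ONLY representative with integer coefficients
(`listTwo … listSix`: the words with letter `u` in the `u∕v` slots only, coefficients = RESULT 5's `NORM` coefficients in the M-basis):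
a DIFFERENT functional on the full word space with (i) coefficient sum `0` inside its degree — so it, too, annihilates `ℚ[h] ⊕ W`
(`lists_spec`, `six_eq_zero_of_classScreen`) — and (ii) THE SAME VALUE as Λ_k on every balanced class tensor (`six_chTensor_phiVec`:
the closed forms `formTwo … formSix` are RESULT 5's polynomials verbatim). The presence clauses only read values, so nothing is lost.

CONTENT (all PROVED; no `sorry`; axioms standard).
* §1 `wfunL L` (the `R`-linear functional of a list of (integer coefficient, word) pairs), `wfunL_apply`, **`wfunL_eq_zero_of_classScreen`**:
  the LIST FORM of the annihilator criterion (all words of `L` e-free of one degree, coefficient sum `0` ⇒ kills the screen).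
* §2 the six lists, `lists_spec` (`decide`: pure degrees 2,3,4,4,5,6, coefficient sums 0), **`six_eq_zero_of_classScreen`**.
* §3 `formTwo … formSix` and **`six_chTensor_phiVec`** (the closed forms for ALL `α, β, β̄, p` over any commutative ring, `ring`);
  **`lamTwelve_eq_two_mul_sub`: `Λ₁₂ = 2·(Λ₄a − Λ₄b)` on every class function** (= «psi ≡ (Λ₄a − Λ₄b)∕6», since `Λ₁₂ = 12Λ = 12·psi`-functional).
* §4 ON 𝔅(μ₄): `rphi`, `MCell.chReal` (the integer e-free tensor), `bphi_eq_cast`, `MCell.ch_eq_cast`, `MCell.wfunL_ch` (an e-free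
  functional of `ch Z` is the cast of its integer value), `MCell.six_chReal` (the six integer values = the closed forms at `α_f`,
  `p_f = α_f² − |β_f|²` — `efree.py norm_vals`); **`MConfig.wrow_of_classScreen`** (any e-free pure-degree zero-sum list `L`, any integer
  multiplicities: (A1) ⇒ `Σ_N m_N Λ_L(N) = Σ_P m_P Λ_L(P)`); `MConfig.HasPos ∕ HasNeg ∕ SignedClause v` (the presence clause of a class
  functional, the shape of `MConfig.PsiClause`); **`MConfig.signedClause_of_row`** (positive multiplicities); **`MConfig.sixClauses_of_classScreen`:
  for EVERY `m ≥ 1`, (A1) ⇒ the presence clauses of Λ₂, Λ₃, Λ₄a, Λ₄b, Λ₅, Λ₆** — the class-side clauses of the W-SEARCH-Δ FULL recipe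
  (RESULT 5 RECIPE; card W14 encoder requirement) are necessary conditions of (A1), so a coupled UNSAT stays an (A1)-verdict.
* §5 probe (`decide`): `fcCell_six` — on the lone fully charged ray class `[ℓ₁|ℓ₋ᵢ|ℓ₋₁|ℓ_i]`: `Λ₂ = −12, Λ₃ = −12, Λ₄a = 0, Λ₄b = −6,
  Λ₅ = 0, Λ₆ = 0` (RESULT 5: «on ray-only classes Λ₄b = −6e₄(α), non-zero exactly on FC classes; Λ₄a, Λ₅, Λ₆ vanish with the p-entries»;
  its presence check «W10 ∕ Wmin killed by Λ₄b ALONE: the lone FC class»).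

WHAT IS NOT HERE ∕ NOT IN LEAN. The «only if» half of RESULT 5 (that these six SPAN the S₄-symmetric e-free annihilators — a dimension
count, not needed for soundness); RESULT 5's sign statistics over ◇₆ ∕ ◇₈ (3 775 shape multisets — tables, not theorems; only the one-cell
probe above); FC-CORE-Δ and the Δ-orbit bookkeeping (RESULT 4; kernel FC-CORE is `Pad4FCCore` ∕ `Pad4FCCoreParity`, gs-eng-2 g51); the
encoder itself and any SAT verdict. The frame's identification with `H^{ev}(S⁴)` ∕ `ℚ[h] ⊕ W` stays the cell's pencil modelling sentence
(gs-eng-2 g44 §11, PAD4-THEOREM-L (6.5)∕(6.6)), as in the two predecessors. No variety, sheaf, σ, seed or abelian variety; NOTHING HERE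
SAYS THAT HC ∕ HC_CM ∕ HC_AV ∕ W₆ ∕ HC_Kum4Type HOLDS OR FAILS. No `instance`, no notation, no named fact, 0 `sorry`.

SOURCES (sha16): gs-eng-2 g51 RESULT 5 cell INBOX l.31736; efree.py ca398a04069a5de3 (`TYPES`, `functionals`, `NORM`, `PLAC`, `norm_vals`);
bc5-plan g6 card v4.10 440016c9592a702a rows W13 (B′) ∕ W14; tree∕staged predecessors `Pad4TowerClassScreen.lean` 1ffb82cfe6f0a1dc,
`Pad4TowerPsiSubA1.lean` 8a8ffcebf99475df (this typer), `Pad4TowerCrossPhase.lean` 8f09792281b0723a (`MCell`, `MConfig`, `lpt`, `mcellOf`).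
-/

namespace Summit.Ventures.HSemireg.Pad4Tower

open Finset Summit.Ventures.HSemireg.Pad4FirstOrder

section Frame

variable {R : Type*} [CommRing R]

/-! ## §1 Word-list functionals and the list form of the annihilator criterion -/

/-- the functional `T ↦ Σ_{(c, w) ∈ L} c · T(w)` of a list of (integer coefficient, word) pairs, `R`-linear. -/
def wfunL (L : List (ℤ × CWord)) : (CWord → R) →ₗ[R] R := (L.map fun cw => (cw.1 : R) • evalW (R := R) cw.2).sum

/-- `wfunL` written out. -/
theorem wfunL_apply (L : List (ℤ × CWord)) (T : CWord → R) :
    wfunL L T = (L.map fun cw => (cw.1 : R) * T cw.2).sum := by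
  induction L with
  | nil => simp [wfunL]
  | cons a L ih =>
    simp only [wfunL, List.map_cons, List.sum_cons, LinearMap.add_apply, LinearMap.smul_apply, LinearMap.coe_proj,
      Function.eval, smul_eq_mul] at ih ⊢
    rw [ih]

/-- **LIST FORM OF THE ANNIHILATOR CRITERION** (gs-eng-2 g51 RESULT 5: «annihilates `ℚ[h] ⊕ W` iff its coefficients sum to 0 inside
its degree»): if every word of `L` is e-free of one degree `d` and the coefficients of `L` sum to `0`, then `wfunL L` kills every class
function passing the class screen. -/
theorem wfunL_eq_zero_of_classScreen (L : List (ℤ × CWord)) (d : ℕ) (hL : ∀ cw ∈ L, EFree cw.2 ∧ wdeg cw.2 = d)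
    (hsum : (L.map Prod.fst).sum = 0) (T : CWord → R) (h : ClassScreen T) : wfunL L T = 0 := by
  obtain ⟨-, hd⟩ := h
  rw [wfunL_apply]
  cases L with
  | nil => simp
  | cons a L =>
    have ha := hL a (by simp)
    have e : ∀ cw ∈ a :: L, (cw.1 : R) * T cw.2 = (cw.1 : R) * T a.2 := fun cw hcw => by
      rw [hd cw.2 a.2 (hL cw hcw).1 ha.1 (by rw [(hL cw hcw).2, ha.2])]
    rw [List.map_congr_left e, List.sum_map_mul_right]
    have : ((a :: L).map fun cw => (cw.1 : R)).sum = (((a :: L).map Prod.fst).sum : ℤ) := by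
      rw [Int.cast_list_sum, List.map_map]
      rfl
    rw [this, hsum, Int.cast_zero, zero_mul]

/-! ## §2 The six functionals (u-only representatives, integer coefficients) -/

/-- **Λ₂** `= 3·Σ_f s_f − 2·e₂(α)` (degree 2): coefficient `3` on the four words `[p 1 1 1]`, `−2` on the six words `[u u 1 1]`
(`3·4 − 2·6 = 0`). -/
def listTwo : List (ℤ × CWord) :=
  [(3, ![5, 0, 0, 0]), (3, ![0, 5, 0, 0]), (3, ![0, 0, 5, 0]), (3, ![0, 0, 0, 5]), (-2, ![1, 1, 0, 0]),
    (-2, ![1, 0, 1, 0]), (-2, ![1, 0, 0, 1]), (-2, ![0, 1, 1, 0]), (-2, ![0, 1, 0, 1]), (-2, ![0, 0, 1, 1])]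

/-- **Λ₃** `= Σ_{f≠g} s_f α_g − 3·e₃(α)` (degree 3): `1` on the twelve `[p u 1 1]`, `−3` on the four `[u u u 1]` (`12 − 12 = 0`). -/
def listThree : List (ℤ × CWord) :=
  [(1, ![5, 1, 0, 0]), (1, ![5, 0, 1, 0]), (1, ![5, 0, 0, 1]), (1, ![1, 5, 0, 0]), (1, ![0, 5, 1, 0]),
    (1, ![0, 5, 0, 1]), (1, ![1, 0, 5, 0]), (1, ![0, 1, 5, 0]), (1, ![0, 0, 5, 1]), (1, ![1, 0, 0, 5]),
    (1, ![0, 1, 0, 5]), (1, ![0, 0, 1, 5]), (-3, ![1, 1, 1, 0]), (-3, ![1, 1, 0, 1]), (-3, ![1, 0, 1, 1]),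
    (-3, ![0, 1, 1, 1])]

/-- **Λ₄a** `= 2·Σ_{f<g} s_f s_g − Σ_j s_j e₂(α∖j)` (degree 4): `2` on the six `[p p 1 1]`, `−1` on the twelve `[p u u 1]`
(`12 − 12 = 0`). -/
def listFourA : List (ℤ × CWord) :=
  [(2, ![5, 5, 0, 0]), (2, ![5, 0, 5, 0]), (2, ![5, 0, 0, 5]), (2, ![0, 5, 5, 0]), (2, ![0, 5, 0, 5]),
    (2, ![0, 0, 5, 5]), (-1, ![5, 1, 1, 0]), (-1, ![5, 1, 0, 1]), (-1, ![5, 0, 1, 1]), (-1, ![1, 5, 1, 0]),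
    (-1, ![1, 5, 0, 1]), (-1, ![0, 5, 1, 1]), (-1, ![1, 1, 5, 0]), (-1, ![1, 0, 5, 1]), (-1, ![0, 1, 5, 1]),
    (-1, ![1, 1, 0, 5]), (-1, ![1, 0, 1, 5]), (-1, ![0, 1, 1, 5])]

/-- **Λ₄b** `= Σ_{f<g} s_f s_g − 6·e₄(α)` (degree 4): `1` on the six `[p p 1 1]`, `−6` on `[u u u u]` (`6 − 6 = 0`). -/
def listFourB : List (ℤ × CWord) :=
  [(1, ![5, 5, 0, 0]), (1, ![5, 0, 5, 0]), (1, ![5, 0, 0, 5]), (1, ![0, 5, 5, 0]), (1, ![0, 5, 0, 5]),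
    (1, ![0, 0, 5, 5]), (-6, ![1, 1, 1, 1])]

/-- **Λ₅** `= Σ_{f<g, h∉{f,g}} s_f s_g α_h − 3·Σ_j s_j e₃(α∖j)` (degree 5): `1` on the twelve `[p p u 1]`, `−3` on the four `[p u u u]`
(`12 − 12 = 0`). -/
def listFive : List (ℤ × CWord) :=
  [(1, ![5, 5, 1, 0]), (1, ![5, 5, 0, 1]), (1, ![5, 1, 5, 0]), (1, ![5, 0, 5, 1]), (1, ![5, 1, 0, 5]),
    (1, ![5, 0, 1, 5]), (1, ![1, 5, 5, 0]), (1, ![0, 5, 5, 1]), (1, ![1, 5, 0, 5]), (1, ![0, 5, 1, 5]),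
    (1, ![1, 0, 5, 5]), (1, ![0, 1, 5, 5]), (-3, ![5, 1, 1, 1]), (-3, ![1, 5, 1, 1]), (-3, ![1, 1, 5, 1]),
    (-3, ![1, 1, 1, 5])]

/-- **Λ₆** `= 3·e₃(s) − 2·Σ_{f<g} s_f s_g α_k α_l` (degree 6): `3` on the four `[p p p 1]`, `−2` on the six `[p p u u]` (`12 − 12 = 0`). -/
def listSix : List (ℤ × CWord) :=
  [(3, ![5, 5, 5, 0]), (3, ![5, 5, 0, 5]), (3, ![5, 0, 5, 5]), (3, ![0, 5, 5, 5]), (-2, ![5, 5, 1, 1]),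
    (-2, ![5, 1, 5, 1]), (-2, ![5, 1, 1, 5]), (-2, ![1, 5, 5, 1]), (-2, ![1, 5, 1, 5]), (-2, ![1, 1, 5, 5])]

/-- the six lists are e-free of pure degree `2, 3, 4, 4, 5, 6` with coefficient sums `0`. [`decide`] -/
theorem lists_spec :
    ((∀ cw ∈ listTwo, EFree cw.2 ∧ wdeg cw.2 = 2) ∧ (listTwo.map Prod.fst).sum = 0) ∧
    ((∀ cw ∈ listThree, EFree cw.2 ∧ wdeg cw.2 = 3) ∧ (listThree.map Prod.fst).sum = 0) ∧
    ((∀ cw ∈ listFourA, EFree cw.2 ∧ wdeg cw.2 = 4) ∧ (listFourA.map Prod.fst).sum = 0) ∧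
    ((∀ cw ∈ listFourB, EFree cw.2 ∧ wdeg cw.2 = 4) ∧ (listFourB.map Prod.fst).sum = 0) ∧
    ((∀ cw ∈ listFive, EFree cw.2 ∧ wdeg cw.2 = 5) ∧ (listFive.map Prod.fst).sum = 0) ∧
    ((∀ cw ∈ listSix, EFree cw.2 ∧ wdeg cw.2 = 6) ∧ (listSix.map Prod.fst).sum = 0) := by
  decide

/-- **THE SIX FUNCTIONALS ANNIHILATE every class function passing the class screen** ((A1) ⇒ `Λ_k = 0`, `k = 2, 3, 4a, 4b, 5, 6`). -/
theorem six_eq_zero_of_classScreen (T : CWord → R) (h : ClassScreen T) :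
    wfunL listTwo T = 0 ∧ wfunL listThree T = 0 ∧ wfunL listFourA T = 0 ∧ wfunL listFourB T = 0 ∧
      wfunL listFive T = 0 ∧ wfunL listSix T = 0 := by
  obtain ⟨⟨a1, a2⟩, ⟨b1, b2⟩, ⟨c1, c2⟩, ⟨d1, d2⟩, ⟨e1, e2⟩, ⟨f1, f2⟩⟩ := lists_spec
  exact ⟨wfunL_eq_zero_of_classScreen _ 2 a1 a2 T h, wfunL_eq_zero_of_classScreen _ 3 b1 b2 T h,
    wfunL_eq_zero_of_classScreen _ 4 c1 c2 T h, wfunL_eq_zero_of_classScreen _ 4 d1 d2 T h,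
    wfunL_eq_zero_of_classScreen _ 5 e1 e2 T h, wfunL_eq_zero_of_classScreen _ 6 f1 f2 T h⟩

/-! ## §3 Closed forms on balanced blocks (ring identities; `p_f` = the `p`-entry `α_f² − |β_f|²` = RESULT 5's `s_f`) -/

/-- closed form of Λ₂: `3·Σ_f p_f − 2·e₂(α)`. -/
def formTwo (α p : Fin 4 → R) : R :=
  3 * (p 0 + p 1 + p 2 + p 3) - 2 * (α 0 * α 1 + α 0 * α 2 + α 0 * α 3 + α 1 * α 2 + α 1 * α 3 + α 2 * α 3)

/-- closed form of Λ₃: `Σ_{f≠g} p_f α_g − 3·e₃(α)`. -/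
def formThree (α p : Fin 4 → R) : R :=
  (p 0 * α 1 + p 0 * α 2 + p 0 * α 3 + p 1 * α 0 + p 1 * α 2 + p 1 * α 3 + p 2 * α 0 + p 2 * α 1 + p 2 * α 3
    + p 3 * α 0 + p 3 * α 1 + p 3 * α 2) - 3 * (α 0 * α 1 * α 2 + α 0 * α 1 * α 3 + α 0 * α 2 * α 3 + α 1 * α 2 * α 3)

/-- closed form of Λ₄a: `2·Σ_{f<g} p_f p_g − Σ_j p_j e₂(α∖j)`. -/
def formFourA (α p : Fin 4 → R) : R :=
  2 * (p 0 * p 1 + p 0 * p 2 + p 0 * p 3 + p 1 * p 2 + p 1 * p 3 + p 2 * p 3)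
    - (p 0 * α 1 * α 2 + p 0 * α 1 * α 3 + p 0 * α 2 * α 3 + p 1 * α 0 * α 2 + p 1 * α 0 * α 3 + p 1 * α 2 * α 3
      + p 2 * α 0 * α 1 + p 2 * α 0 * α 3 + p 2 * α 1 * α 3 + p 3 * α 0 * α 1 + p 3 * α 0 * α 2 + p 3 * α 1 * α 2)

/-- closed form of Λ₄b: `Σ_{f<g} p_f p_g − 6·e₄(α)`. -/
def formFourB (α p : Fin 4 → R) : R :=
  (p 0 * p 1 + p 0 * p 2 + p 0 * p 3 + p 1 * p 2 + p 1 * p 3 + p 2 * p 3) - 6 * (α 0 * α 1 * α 2 * α 3)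

/-- closed form of Λ₅: `Σ_{f<g, h∉{f,g}} p_f p_g α_h − 3·Σ_j p_j e₃(α∖j)`. -/
def formFive (α p : Fin 4 → R) : R :=
  (p 0 * p 1 * α 2 + p 0 * p 1 * α 3 + p 0 * p 2 * α 1 + p 0 * p 2 * α 3 + p 0 * p 3 * α 1 + p 0 * p 3 * α 2
    + p 1 * p 2 * α 0 + p 1 * p 2 * α 3 + p 1 * p 3 * α 0 + p 1 * p 3 * α 2 + p 2 * p 3 * α 0 + p 2 * p 3 * α 1)
    - 3 * (p 0 * α 1 * α 2 * α 3 + p 1 * α 0 * α 2 * α 3 + p 2 * α 0 * α 1 * α 3 + p 3 * α 0 * α 1 * α 2)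

/-- closed form of Λ₆: `3·e₃(p) − 2·Σ_{f<g} p_f p_g α_k α_l` (`{k,l}` the complementary pair). -/
def formSix (α p : Fin 4 → R) : R :=
  3 * (p 0 * p 1 * p 2 + p 0 * p 1 * p 3 + p 0 * p 2 * p 3 + p 1 * p 2 * p 3)
    - 2 * (p 0 * p 1 * α 2 * α 3 + p 0 * p 2 * α 1 * α 3 + p 0 * p 3 * α 1 * α 2 + p 1 * p 2 * α 0 * α 3
      + p 1 * p 3 * α 0 * α 2 + p 2 * p 3 * α 0 * α 1)

/-- **CLOSED FORMS** (gs-eng-2 g51 RESULT 5, `efree.py` ca398a04069a5de3 `NORM`): on the class tensor of four balanced letter vectors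
`(1, α_f, α_f, β_f, β̄_f, p_f)` the six functionals evaluate to `formTwo … formSix` in `(α, p)` — for ALL entries, in any commutative
ring. [`ring`] -/
theorem six_chTensor_phiVec (α β βc p : Fin 4 → R) :
    wfunL listTwo (chTensor fun f => phiVec (α f) (β f) (βc f) (p f)) = formTwo α p ∧
    wfunL listThree (chTensor fun f => phiVec (α f) (β f) (βc f) (p f)) = formThree α p ∧
    wfunL listFourA (chTensor fun f => phiVec (α f) (β f) (βc f) (p f)) = formFourA α p ∧
    wfunL listFourB (chTensor fun f => phiVec (α f) (β f) (βc f) (p f)) = formFourB α p ∧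
    wfunL listFive (chTensor fun f => phiVec (α f) (β f) (βc f) (p f)) = formFive α p ∧
    wfunL listSix (chTensor fun f => phiVec (α f) (β f) (βc f) (p f)) = formSix α p := by
  simp only [wfunL_apply, listTwo, listThree, listFourA, listFourB, listFive, listSix, formTwo, formThree, formFourA,
    formFourB, formFive, formSix, chTensor, phiVec, List.map_cons, List.map_nil, List.sum_cons, List.sum_nil]
  simp only [Matrix.cons_val_zero, Matrix.cons_val_one, Matrix.cons_val]
  push_cast
  refine ⟨by ring, by ring, by ring, by ring, by ring, by ring⟩

/-- **`Ψ = (Λ₄a − Λ₄b) ∕ 6`** (RESULT 5: «psi ≡ (Λ₄a − Λ₄b)∕6 … = bc5-plan g6's Λ, fourth code path»), as functionals: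
`Λ₁₂ = 12Λ = 2·(Λ₄a − Λ₄b)` on EVERY class function (the word lists coincide: `[uuuu]`, the twelve `[p u u 1]`, the six `[p p 1 1]`). -/
theorem lamTwelve_eq_two_mul_sub (T : CWord → R) : lamTwelve T = 2 * (wfunL listFourA T - wfunL listFourB T) := by
  simp only [lamTwelve_apply, wfunL_apply, listFourA, listFourB, List.map_cons, List.map_nil, List.sum_cons, List.sum_nil]
  push_cast
  ring

end Frame

/-! ## §4 On 𝔅(μ₄): integer values on cells, the rows under (A1), and the five presence clauses -/

/-- the REAL (e-free) letter vector of a factor point: `(1, α, α, 0, 0, α² − |β|²) ∈ ℤ⁶` (the entries an e-free functional reads). -/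
def rphi (x : BPoint) : Fin 6 → ℤ := phiVec x.1 0 0 (x.1 ^ 2 - x.2.1 ^ 2 - x.2.2 ^ 2)

/-- the e-free integer class tensor of a cell. -/
def MCell.chReal (Z : MCell) : CWord → ℤ := chTensor fun f => rphi (Z f)

/-- on letters other than `e`, `ē` the `ℤ[i]` letter vector is the cast of the real one. -/
theorem bphi_eq_cast (x : BPoint) (l : Fin 6) (h3 : l ≠ 3) (h4 : l ≠ 4) : bphi x l = ((rphi x l : ℤ) : GaussianInt) := by
  fin_cases l <;> simp_all [bphi, rphi, phiVec]

/-- on e-free words the class tensor of a cell is the cast of its real tensor. -/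
theorem MCell.ch_eq_cast (Z : MCell) (w : CWord) (hw : EFree w) : Z.ch w = ((Z.chReal w : ℤ) : GaussianInt) := by
  simp only [MCell.ch, MCell.chReal, chTensor, bphi_eq_cast _ _ (hw _).1 (hw _).2, Int.cast_mul]

/-- an e-free word-list functional of a cell's class tensor is the cast of its value on the real tensor. -/
theorem MCell.wfunL_ch (L : List (ℤ × CWord)) (hL : ∀ cw ∈ L, EFree cw.2) (Z : MCell) :
    wfunL L Z.ch = ((wfunL L Z.chReal : ℤ) : GaussianInt) := by
  rw [wfunL_apply, wfunL_apply, Int.cast_list_sum, List.map_map]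
  refine congrArg _ (List.map_congr_left fun cw hcw => ?_)
  simp [Z.ch_eq_cast _ (hL cw hcw)]

/-- the six integer VALUES of a cell: `formK` at `α_f`, `p_f = α_f² − |β_f|²` (RESULT 5's `s_f`; `efree.py norm_vals`). -/
theorem MCell.six_chReal (Z : MCell) :
    wfunL listTwo Z.chReal = formTwo (fun f => (Z f).1) (fun f => (Z f).1 ^ 2 - (Z f).2.1 ^ 2 - (Z f).2.2 ^ 2) ∧
    wfunL listThree Z.chReal = formThree (fun f => (Z f).1) (fun f => (Z f).1 ^ 2 - (Z f).2.1 ^ 2 - (Z f).2.2 ^ 2) ∧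
    wfunL listFourA Z.chReal = formFourA (fun f => (Z f).1) (fun f => (Z f).1 ^ 2 - (Z f).2.1 ^ 2 - (Z f).2.2 ^ 2) ∧
    wfunL listFourB Z.chReal = formFourB (fun f => (Z f).1) (fun f => (Z f).1 ^ 2 - (Z f).2.1 ^ 2 - (Z f).2.2 ^ 2) ∧
    wfunL listFive Z.chReal = formFive (fun f => (Z f).1) (fun f => (Z f).1 ^ 2 - (Z f).2.1 ^ 2 - (Z f).2.2 ^ 2) ∧
    wfunL listSix Z.chReal = formSix (fun f => (Z f).1) (fun f => (Z f).1 ^ 2 - (Z f).2.1 ^ 2 - (Z f).2.2 ^ 2) :=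
  six_chTensor_phiVec (R := ℤ) _ (fun _ => 0) (fun _ => 0) _

/-- **THE ROW of an e-free annihilator under (A1) on 𝔅(μ₄)**: for a word list `L` e-free of one degree with coefficient sum `0`, every
configuration with integer multiplicities whose weighted class tensor passes the class screen has `Σ_N m_N Λ_L(N) = Σ_P m_P Λ_L(P)`
(`Λ_L(Z) := wfunL L Z.chReal`). -/
theorem MConfig.wrow_of_classScreen (L : List (ℤ × CWord)) (d : ℕ) (hL : ∀ cw ∈ L, EFree cw.2 ∧ wdeg cw.2 = d)
    (hsum : (L.map Prod.fst).sum = 0) (C : MConfig) (mN mP : MCell → ℤ) (h : ClassScreen (C.wch mN mP)) :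
    ∑ Z ∈ C.lower, mN Z * wfunL L Z.chReal = ∑ P ∈ C.upper, mP P * wfunL L P.chReal := by
  have h0 := wfunL_eq_zero_of_classScreen L d hL hsum _ h
  have hL' : ∀ cw ∈ L, EFree cw.2 := fun cw hcw => (hL cw hcw).1
  simp only [MConfig.wch, map_sub, map_sum, map_zsmul, MCell.wfunL_ch L hL'] at h0
  simp only [zsmul_eq_mul] at h0
  have h1 : ((∑ Z ∈ C.lower, mN Z * wfunL L Z.chReal - ∑ P ∈ C.upper, mP P * wfunL L P.chReal : ℤ) : GaussianInt) = 0 := by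
    push_cast
    exact h0
  linarith [Int.cast_eq_zero.1 h1]

/-- a positive SIGNED value of `v` is present (`+v` on `N`, `−v` on `P`). Decidable for decidable `v`-comparisons. -/
abbrev MConfig.HasPos (C : MConfig) (v : MCell → ℤ) : Prop := (∃ Z ∈ C.lower, 0 < v Z) ∨ ∃ P ∈ C.upper, v P < 0

/-- a negative signed value of `v` is present. -/
abbrev MConfig.HasNeg (C : MConfig) (v : MCell → ℤ) : Prop := (∃ Z ∈ C.lower, v Z < 0) ∨ ∃ P ∈ C.upper, 0 < v P

/-- **the PRESENCE CLAUSE of a class functional `v`** (RESULT 5: «some class with `ε·Λ_k > 0` present ⇒ some class with `ε·Λ_k < 0`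
present, and conversely» — the shape of the Ψ-clause `MConfig.PsiClause`). -/
abbrev MConfig.SignedClause (C : MConfig) (v : MCell → ℤ) : Prop := (C.HasPos v → C.HasNeg v) ∧ (C.HasNeg v → C.HasPos v)

/-- a ROW with positive multiplicities implies the presence clause. -/
theorem MConfig.signedClause_of_row (C : MConfig) (v mN mP : MCell → ℤ) (hN : ∀ Z ∈ C.lower, 0 < mN Z)
    (hP : ∀ P ∈ C.upper, 0 < mP P) (hrow : ∑ Z ∈ C.lower, mN Z * v Z = ∑ P ∈ C.upper, mP P * v P) :
    C.SignedClause v := by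
  constructor
  · intro hpos
    by_contra hneg
    simp only [MConfig.HasNeg, not_or, not_exists, not_and, not_lt] at hneg
    have hl : ∀ Z ∈ C.lower, 0 ≤ mN Z * v Z := fun Z hZ => mul_nonneg (hN Z hZ).le (hneg.1 Z hZ)
    have hu : ∀ P ∈ C.upper, mP P * v P ≤ 0 := fun P hP' => mul_nonpos_of_nonneg_of_nonpos (hP P hP').le (hneg.2 P hP')
    rcases hpos with ⟨Z, hZ, hZp⟩ | ⟨P, hPm, hPn⟩
    · have h1 : 0 < mN Z * v Z := mul_pos (hN Z hZ) hZp
      have h2 : mN Z * v Z ≤ ∑ Z ∈ C.lower, mN Z * v Z := Finset.single_le_sum hl hZ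
      have h3 : ∑ P ∈ C.upper, mP P * v P ≤ 0 := Finset.sum_nonpos hu
      linarith
    · have h1 : mP P * v P < 0 := mul_neg_of_pos_of_neg (hP P hPm) hPn
      have h2 : ∑ P ∈ C.upper, mP P * v P - mP P * v P ≤ 0 := by
        rw [← Finset.sum_erase_eq_sub hPm]
        exact Finset.sum_nonpos fun x hx => hu x (Finset.mem_of_mem_erase hx)
      have h3 : 0 ≤ ∑ Z ∈ C.lower, mN Z * v Z := Finset.sum_nonneg hl
      linarith
  · intro hneg
    by_contra hpos
    simp only [MConfig.HasPos, not_or, not_exists, not_and, not_lt] at hpos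
    have hl : ∀ Z ∈ C.lower, mN Z * v Z ≤ 0 := fun Z hZ => mul_nonpos_of_nonneg_of_nonpos (hN Z hZ).le (hpos.1 Z hZ)
    have hu : ∀ P ∈ C.upper, 0 ≤ mP P * v P := fun P hP' => mul_nonneg (hP P hP').le (hpos.2 P hP')
    rcases hneg with ⟨Z, hZ, hZn⟩ | ⟨P, hPm, hPp⟩
    · have h1 : mN Z * v Z < 0 := mul_neg_of_pos_of_neg (hN Z hZ) hZn
      have h2 : ∑ Z ∈ C.lower, mN Z * v Z - mN Z * v Z ≤ 0 := by
        rw [← Finset.sum_erase_eq_sub hZ]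
        exact Finset.sum_nonpos fun x hx => hl x (Finset.mem_of_mem_erase hx)
      have h3 : 0 ≤ ∑ P ∈ C.upper, mP P * v P := Finset.sum_nonneg hu
      linarith
    · have h1 : 0 < mP P * v P := mul_pos (hP P hPm) hPp
      have h2 : mP P * v P ≤ ∑ P ∈ C.upper, mP P * v P := Finset.single_le_sum hu hPm
      have h3 : ∑ Z ∈ C.lower, mN Z * v Z ≤ 0 := Finset.sum_nonpos hl
      linarith

/-- **THE FIVE (SIX) PRESENCE CLAUSES OF THE W-SEARCH-Δ FULL RECIPE ARE SOUND**: for every configuration and every multiplicity vector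
`m ≥ 1` per present class, (A1) — the weighted class tensor passes the class screen — implies the presence clause of each of
Λ₂, Λ₃, Λ₄a, Λ₄b, Λ₅, Λ₆ (values `wfunL listK ·.chReal`). -/
theorem MConfig.sixClauses_of_classScreen (C : MConfig) (mN mP : MCell → ℤ) (hN : ∀ Z ∈ C.lower, 0 < mN Z)
    (hP : ∀ P ∈ C.upper, 0 < mP P) (h : ClassScreen (C.wch mN mP)) :
    C.SignedClause (fun Z => wfunL listTwo Z.chReal) ∧ C.SignedClause (fun Z => wfunL listThree Z.chReal) ∧
    C.SignedClause (fun Z => wfunL listFourA Z.chReal) ∧ C.SignedClause (fun Z => wfunL listFourB Z.chReal) ∧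
    C.SignedClause (fun Z => wfunL listFive Z.chReal) ∧ C.SignedClause (fun Z => wfunL listSix Z.chReal) := by
  obtain ⟨⟨a1, a2⟩, ⟨b1, b2⟩, ⟨c1, c2⟩, ⟨d1, d2⟩, ⟨e1, e2⟩, ⟨f1, f2⟩⟩ := lists_spec
  exact ⟨C.signedClause_of_row _ mN mP hN hP (C.wrow_of_classScreen _ 2 a1 a2 mN mP h),
    C.signedClause_of_row _ mN mP hN hP (C.wrow_of_classScreen _ 3 b1 b2 mN mP h),
    C.signedClause_of_row _ mN mP hN hP (C.wrow_of_classScreen _ 4 c1 c2 mN mP h),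
    C.signedClause_of_row _ mN mP hN hP (C.wrow_of_classScreen _ 4 d1 d2 mN mP h),
    C.signedClause_of_row _ mN mP hN hP (C.wrow_of_classScreen _ 5 e1 e2 mN mP h),
    C.signedClause_of_row _ mN mP hN hP (C.wrow_of_classScreen _ 6 f1 f2 mN mP h)⟩

/-! ## §5 Kernel probes -/

/-- RESULT 5's presence check on a lone fully charged ray class: `Λ₄b[ℓ₁|ℓ₋ᵢ|ℓ₋₁|ℓ_i] = −6·e₄(α) = −6` (non-zero exactly on FC ray
classes), `Λ₂ = −2e₂(α) = −12`, `Λ₃ = −3e₃ = −12`, `Λ₄a = Λ₅ = Λ₆ = 0` (all `p_f = 0` on null letters). [kernel, `decide`] -/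
theorem fcCell_six :
    wfunL listTwo fcCell.chReal = -12 ∧ wfunL listThree fcCell.chReal = -12 ∧ wfunL listFourA fcCell.chReal = 0 ∧
    wfunL listFourB fcCell.chReal = -6 ∧ wfunL listFive fcCell.chReal = 0 ∧ wfunL listSix fcCell.chReal = 0 := by
  simp only [wfunL_apply]
  decide +kernel

end Summit.Ventures.HSemireg.Pad4Tower
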